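import Literature.NumberTheory.Automorphic.KimExteriorSquareGL4Proofs
import Literature.NumberTheory.Automorphic.LocalComponentBJ
import HarnessLib

/-!
# Kim's exterior square lift `∧² : GL₄ → GL₆`: Theorem 4.2.3 from its leaves
# (§4.2 — the general case from the good case by base change and descent)

Sibling proof file (theorems only; no `sorry`, no definition, no named fact) of
`Literature.NumberTheory.Automorphic.KimExteriorSquareGL4`, whose named fact
`Kim2003_exteriorSquare_GL4` renders H. H. Kim, *Functoriality for the exterior square of `GL₄`
and the symmetric fourth of `GL₂`*, J. Amer. Math. Soc. **16** (2003) 139–183 [Kim2002], Theorem A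
in its weak (Satake) form = **Theorem 4.2.3** (p. 156): *"Let `π` be a cuspidal representation of
`GL₄(𝔸_F)`. Then there exists a weak exterior square lift `Π` of `GL₆(𝔸_F)`. It is of the form
`τ₁ ⊞ ⋯ ⊞ τ_k`"*. Sequel to `KimExteriorSquareGL4Proofs` (the algebra of `∧²` on Satake parameters
and the base-change bookkeeping of §4.2).

This file formalises the **architecture of Kim's proof of Theorem 4.2.3** (§4.2, pp. 156–158,
"We follow [Ra1] closely"): the induction on `r(π)` over all number fields which reduces the
general case to the good case (Theorem 4.1.1, §4.1) by Henniart's trick, cyclic base change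
(Arthur–Clozel) and Ramakrishnan's descent criterion (Prop. 4.2.4–4.2.5), in the idiom of
`Ramakrishnan2000_theoremM.of_leaves` (`RamakrishnanTheoremMExistence`): the published ingredients
of the printed proof that have no carrier in the tree are stated **inline as hypotheses** of the
theorems (no named fact is introduced), each in the tree's Satake-parameter vocabulary, and
Theorem 4.2.3 — the fact `Kim2003_exteriorSquare_GL4` — is PROVED from them
(`Kim2003_exteriorSquare_GL4.of_leaves`).

## The leaves (hypotheses; Kim's notation, `t_{π,v}` = Satake parameter, `f(w|v)` = residue degree)

The induction runs on an invariant `r(π)` with values in a well-ordered set (Kim: the pair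
`r(π) = (l(π), p(π))` ordered lexicographically, p. 156, built from Henniart's lengths `l(π_v)` of
the supercuspidal components — local data with no carrier in the tree), and on the dichotomy
"`π` good" (no supercuspidal component, p. 153) / "not good". Both are taken ABSTRACTLY: the
theorems hold for every predicate `Good` and every rank function `rk` into a type with a
well-founded `<` for which the leaves hold; Kim's proof supplies his.

* `hGood` — **the good case with its exceptional set** (Thm. 4.1.1 and its proof, pp. 153–154:
  "we can apply the converse theorem (Theorem 2.1) to `∧²π` and `S`, where `S` is a finite set of
  finite places such that `π_v` is unramified for `v ∉ S` … there exists an automorphic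
  representation `Π = ⊗ Π_v` of `GL₆(𝔸)` such that `Π_v ≃ ∧²π_v` for all `v ∉ S`"; Thm. 2.1 is the
  converse theorem of Cogdell–Piatetski-Shapiro [Co-PS1], the analytic input being §3
  (Langlands–Shahidi method on `Spin(2n)`, Prop. 3.4, Thm. 3.5 [Ge-Sh]) and Prop. 4.1–4.2): for
  good `π` and every finite non-empty set `S` of finite places outside which `π` is unramified,
  some automorphic `P` on `GL₆(𝔸_K)` has `t_{P,v} = ∧² t_{π,v}` at EVERY `v ∉ S`. (`S ≠ ∅`: the
  proof twists by a character highly ramified at a place of `S`, p. 153.)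
* `hStep` — **the family of the induction step** (p. 156–157, for `π` not good; Thm. 4.2.1 [He1] =
  Henniart, the Grunwald–Wang theorem [A-T, Ch. 10, Thm. 5], class field theory, the Chebotarev
  density theorem, Lemma 4.2.2 [Ra1, Lemma 3.6.2] with [Ra1, Prop. 2.3.1], and base change
  [Arthur–Clozel, Ch. 3, Thm. 4.2 (a), Thm. 5.1]): given any sequence `(v_j)_{j ∈ ℕ}` of finite
  places at which `π` is unramified, there are a prime `p` and, for all `j` outside a finite set of
  indices (Kim: "by throwing away finitely many indices"), pairwise non-isomorphic Galois
  extensions `K_j/K` of degree `p` in which `v_j` splits completely (a place `w_j ∣ v_j` with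
  `e = f = 1`), together with CUSPIDAL base changes `π_{K_j}` of `π` (`t_{π_{K_j},w} = t_{π,v}^{f(w|v)}`
  at every place `w ∣ v` at which `π` is unramified — Arthur–Clozel's lift is a strong lift,
  Thm. 5.1) with `r(π_{K_j}) < r(π)` ("So by construction, for every `j ≥ 1`, `r(π_{K_j}) < r`",
  p. 157).
* `hDescent` — **Ramakrishnan's descent criterion for isobaric families** (Prop. 4.2.4 [Ra1, §3.6]
  and Prop. 4.2.5 = Appendix 1, with Remark 4.2), on Satake parameters: for a countable infinite
  family of pairwise non-isomorphic Galois extensions `K_j/F` of prime degree `p` and automorphic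
  `Π_j` on `GL_n(𝔸_{K_j})` "induced from cuspidal representations" (p. 157: an a.e. description
  `t_{Π_j} = ⊎ᵢ t_{σᵢ}` by cuspidal data) satisfying the descent condition **(DC)** — for all
  `j, r`, the base changes of `Π_j` and `Π_r` to (any common overfield `L` of) `K_jK_r` have the
  same Satake parameters almost everywhere, `t_{Π_j,w∩K_j}^{f(w|w∩K_j)} = t_{Π_r,w∩K_r}^{f(w|w∩K_r)}`
  for almost all places `w` of `L` — there is an automorphic `Π` on `GL_n(𝔸_F)` with `Π_{K_j} ≃ Π_j`
  for all but finitely many `j`, rendered by its consequence at split places: for almost all `j`,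
  `t_{Π,v} = t_{Π_j,w}` whenever `w ∣ v` has `e(w|v) = f(w|v) = 1` (Arthur–Clozel, Ch. 3, (1.1) and
  Thm. 5.1: the base change is the identity at a split place).
* `hSupp` — **cuspidal support** (Kim (4.1), p. 154: "By the classification of automorphic
  representations of `GL_n` [J-S3], `Π` is equivalent to a subquotient of
  `Ind |det|^{r₁}τ₁ ⊗ ⋯ ⊗ |det|^{r_k}τ_k` … the Hecke conjugacy class of `Π_v` is the same as that
  of `Ξ_v`"; R. P. Langlands, *On the notion of an automorphic representation*, Corvallis 1979,
  Prop. 2): every automorphic `P` on `GL_n(𝔸_F)` has cuspidal data `σᵢ` on `GL_{nᵢ}`, `∑ nᵢ = n`,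
  with `t_{P,v} = ⊎ᵢ t_{σᵢ,v}` for almost all `v` — verbatim the isobaric clause (ii) of the fact,
  and the hypothesis `hIso`-shape of `RamakrishnanTheoremMExistence` read backwards.

## What is proved

* `Kim2003_exteriorSquare_GL4.exists_weakLift_exactAt_of_leaves` — **Theorem 4.2.3 by Kim's
  induction** (pp. 156–158), in the sharpened form the induction actually needs: for every
  cuspidal `π` on `GL₄(𝔸_K)` and every finite place `u` there is an automorphic `P` on `GL₆(𝔸_K)`
  with `t_{P,v} = ∧² t_{π,v}` for almost all `v` AND at `v = u` (if `π` is unramified at `u`).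
* `Kim2003_exteriorSquare_GL4.of_leaves` — the named fact from the four leaves.
* `Kim2003_exteriorSquare_GL4.of_leaves'` — the same with Kim's own goodness predicate (p. 153,
  "we say `π` is good if none of `π_v` is supercuspidal", through the tree's local components
  `AutomorphicRepData.HasLocalComponentAt` of `LocalComponentBJ` and `Representation.IsSupercuspidal`)
  and the rank function quantified existentially inside `hStep`: four CLOSED hypotheses, each a
  statement a planner can vendor verbatim as a named fact.
* The Satake-parameter lemmas of the induction step: `exists_enum_infinite_fiber` (enumerations
  with infinite fibres), `AutomorphicRepData.eventually_map_pow_eq_of_wedgeTwoLift_of_baseChange` and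
  `AutomorphicRepData.eventually_descentCondition_of_wedgeTwoLifts` — **Kim's verification of
  (DC)** (p. 157: "both of these local representations correspond to the restriction (to the Weil
  group of `(K_jK_r)_w`) of `∧²φ_v` … Hence … (DC)"), from the tower lemma of
  `KimExteriorSquareGL4Proofs` and the proved uniqueness of Satake parameters
  (`AutomorphicRepData.hasSatakeParamAt_unique_holds`, Flath 1979, Thm. 3).

## The induction, and one point of rigour

Kim's closing step (p. 157: "each (unramified) finite place `v_j` splits completely in `K_j`; let
`w_j` be a divisor of `v_j` in `K_j` … by the definition of base change, for almost all `j`,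
`L(s, σ_{v_j} × Π_{v_j}) = L(s, (σ_{K_j})_{w_j} × (Π_j)_{w_j}) = ⋯ = L(s, σ_{v_j} ⊗ π_{v_j}, ρ_m ⊗ ∧²ρ₄)`")
uses that the lift `Π_j` of `π_{K_j}` is exact AT the place `w_j` — which "weak lift" (Def. 2.2:
almost all places) does not provide at depth `≥ 2` of the induction, the finitely many exceptional
indices of the descent being out of control. The formal proof therefore carries the invariant

  `Φ(π)`: for every finite place `u`, some weak exterior square lift of `π` is exact at `u`,

and runs Kim's construction with the unramified places enumerated WITH INFINITE MULTIPLICITY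
(`exists_enum_infinite_fiber`: every unramified place is `v_j` for infinitely many `j`), choosing
by `Φ(π_{K_j})` the lift `Π_j` exact at `w_j`. The descended `Π` is then exact at `v_j` for all
but finitely many `j`, hence at EVERY unramified place of `π` (each occurs infinitely often among
the `v_j`), which is `Φ(π)` and more. In the good case `Φ(π)` is `hGood` with
`S = {ramified places} ∪ {v₀}`, `v₀ ≠ u` (a number field has infinitely many places). No rigidity /
strong multiplicity one for isobaric representations is needed in this form, and the Grunwald–Wang
construction of p. 156 serves verbatim for sequences with repetitions.

Nothing in this file assumes `Kim2003_exteriorSquare_GL4`; the leaves `hGood` (converse theorem +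
Langlands–Shahidi), `hStep` (Henniart, Grunwald–Wang, Arthur–Clozel), `hDescent` (Ramakrishnan) and
`hSupp` (Langlands) are exactly what separates the tree from `Kim2003_exteriorSquare_GL4_holds`.

## References

* [Kim2002] H. H. Kim, J. Amer. Math. Soc. 16 (2003), 139–183: Thm. 2.1 (p. 143), Def. 2.2
  (p. 144), Thm. 4.1.1 and its proof (pp. 153–154), (4.1) (p. 154), Thm. 4.2.1, Lemma 4.2.2,
  Thm. 4.2.3, Prop. 4.2.4–4.2.5, Remark 4.2 and the proof of Thm. 4.2.3 (pp. 156–158), Appendix 1.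
* [Ramakrishnan2000] D. Ramakrishnan, *Modularity of the Rankin–Selberg `L`-series, and
  multiplicity one for `SL(2)`*, Ann. of Math. (2) 152 (2000), 45–111, §3.6 (descent criterion),
  Lemma 3.6.2, Prop. 2.3.1 ("[Ra1]").
* [ArthurClozelAMS120] J. Arthur, L. Clozel, *Simple algebras, base change, and the advanced theory
  of the trace formula*, Ann. of Math. Stud. 120 (1989), Ch. 3, (1.1), Thm. 4.2 (a), Thm. 5.1.
* [LanglandsCorvallis1979Notion] R. P. Langlands, *On the notion of an automorphic representation*,
  Proc. Sympos. Pure Math. 33 (1979), Part 1, 203–207, Prop. 2.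
* D. Flath, *Decomposition of representations into tensor products*, Corvallis 1979, Thm. 3.
-/

noncomputable section

open scoped Classical MatrixGroups
open IsDedekindDomain NumberField Filter

namespace Literature.NumberTheory.Automorphic

/-! ### Finite places: enumerations with infinite fibres

The infinitude of the finite places of a number field, used by the induction below, is
`infinite_heightOneSpectrum` of `JacquetLanglandsParts` (transitively imported). -/

section Places

/-- **Enumeration with infinite fibres.** A non-empty subset `s` of a countable type is the set
of values of a sequence `e : ℕ → α` taking every value of `s` infinitely often (compose an
enumeration of `s` with the first projection of `ℕ ≃ ℕ × ℕ`). Used to enumerate the unramified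
places of `π` so that each is `v_j` for infinitely many `j` (module docstring). [folklore] -/
theorem exists_enum_infinite_fiber {α : Type*} [Countable α] {s : Set α} (hs : s.Nonempty) :
    ∃ e : ℕ → α, (∀ j, e j ∈ s) ∧ ∀ a ∈ s, {j | e j = a}.Infinite := by
  obtain ⟨f, hf⟩ := (Set.countable_iff_exists_surjective hs).mp s.to_countable
  refine ⟨fun j => (f (Nat.unpair j).1).1, fun j => (f _).2, fun a ha => ?_⟩
  obtain ⟨i, hi⟩ := hf ⟨a, ha⟩
  refine Set.infinite_of_injective_forall_mem (f := fun k : ℕ => Nat.pair i k) ?_ ?_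
  · intro k₁ k₂ h
    have h' := congrArg Nat.unpair h
    simpa [Nat.unpair_pair] using h'
  · intro k
    simp [Nat.unpair_pair, hi]

end Places

/-! ### Kim's verification of (DC) on Satake parameters (p. 157) -/

section DescentCondition

variable {F K L : Type} [Field F] [NumberField F] [Field K] [NumberField K] [Field L]
  [NumberField L] [Algebra F K] [Algebra F L] [Algebra K L] [IsScalarTower F K L]
  {hF4 : isCompact_glFiniteIntegralLevel 4 F} {hK4 : isCompact_glFiniteIntegralLevel 4 K}
  {hK6 : isCompact_glFiniteIntegralLevel 6 K}

/-- **The Satake parameters of `Π_j` seen from the compositum.** Let `π` be automorphic on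
`GL₄(𝔸_F)`, `π_K` a weak base change of `π` to `K` (`t_{π_K,u} = t_{π,v}^{f(u|v)}` for almost all
`u`) and `P_K` a weak exterior square lift of `π_K` over `K`. Then for almost all finite places `w`
of an overfield `L ⊇ K ⊇ F`: if `β` is the Satake parameter of `P_K` at the place `u = w ∩ K`
below `w`, then `β^{f(w|u)} = (∧² t_{π,v})^{f(w|v)}`, `v = w ∩ F` (`f(w|v) = f(w|u) f(u|v)`,
Mathlib `Ideal.inertiaDeg_tower`; uniqueness of Satake parameters,
`AutomorphicRepData.hasSatakeParamAt_unique_holds`) — "both of these local representations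
correspond to the restriction (to the Weil group of `(K_jK_r)_w`) of `∧²φ_v`" (Kim 2003, p. 157).
[cite: Kim2002, §4.2, proof of Thm. 4.2.3, p. 157] -/
theorem AutomorphicRepData.eventually_map_pow_eq_of_wedgeTwoLift_of_baseChange
    (π : AutomorphicRepData (AutomorphyDatum.gl 4 F hF4))
    (πK : AutomorphicRepData (AutomorphyDatum.gl 4 K hK4))
    (PK : AutomorphicRepData (AutomorphyDatum.gl 6 K hK6))
    (hπK : ∀ᶠ u : HeightOneSpectrum (𝓞 K) in cofinite,
      ∀ (v : HeightOneSpectrum (𝓞 F)) (α : Multiset ℂ), u.asIdeal.under (𝓞 F) = v.asIdeal →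
        π.HasSatakeParamAt v α → πK.HasSatakeParamAt u (α.map (· ^ u.asIdeal.inertiaDeg (𝓞 F))))
    (hPK : ∀ᶠ u : HeightOneSpectrum (𝓞 K) in cofinite, ∀ β : Multiset ℂ,
      πK.HasSatakeParamAt u β → PK.HasSatakeParamAt u (wedgeTwoParams β)) :
    ∀ᶠ w : HeightOneSpectrum (𝓞 L) in cofinite,
      ∀ (v : HeightOneSpectrum (𝓞 F)) (α β : Multiset ℂ), w.asIdeal.under (𝓞 F) = v.asIdeal →
        π.HasSatakeParamAt v α → PK.HasSatakeParamAt (w.under (𝓞 K)) β →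
          β.map (· ^ w.asIdeal.inertiaDeg (𝓞 K)) =
            (wedgeTwoParams α).map (· ^ w.asIdeal.inertiaDeg (𝓞 F)) := by
  have h1 := AutomorphicRepData.eventually_hasSatakeParamAt_wedgeTwoLift_of_baseChange
    π πK PK hπK hPK
  filter_upwards [eventually_cofinite_forall_under_eq (E := L) h1] with w h1 v α β hv hα hβ
  have huv : (w.under (𝓞 K)).asIdeal.under (𝓞 F) = v.asIdeal := by
    rw [← hv, HeightOneSpectrum.under_asIdeal, Ideal.under_under]
  have hβ' := h1 (w.under (𝓞 K)) rfl v α huv hα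
  have e : β = (wedgeTwoParams α).map (· ^ (w.under (𝓞 K)).asIdeal.inertiaDeg (𝓞 F)) :=
    PK.hasSatakeParamAt_unique_holds hβ hβ'
  rw [e, Multiset.map_map]
  refine Multiset.map_congr rfl fun x _ => ?_
  haveI : w.asIdeal.LiesOver (w.under (𝓞 K)).asIdeal := ⟨rfl⟩
  rw [Function.comp_apply, ← pow_mul, ← Ideal.inertiaDeg_tower]

/-- **Kim's descent condition (DC), verified** (proof of Thm. 4.2.3, p. 157). Let `π` be
automorphic on `GL₄(𝔸_F)`; let `K, K'` be two extensions of `F` inside a common overfield `L`,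
`π_K, π_{K'}` weak base changes of `π` to `K, K'`, and `P_K, P_{K'}` weak exterior square lifts of
`π_K, π_{K'}`. Then the (virtual) base changes of `P_K` and `P_{K'}` to `L` have the same Satake
parameters almost everywhere: for almost all finite places `w` of `L`, if `β` is the parameter of
`P_K` at `w ∩ K` and `γ` that of `P_{K'}` at `w ∩ K'`, then `β^{f(w|w∩K)} = γ^{f(w|w∩K')}` (both
equal `(∧² t_{π,v})^{f(w|v)}`, `v = w ∩ F`; `π` has a Satake parameter at almost every `v`,
`AutomorphicRepData.hasSatakeParamAt_cofinite_holds`). Kim: "`((Π_j)_{K_jK_r})_w ≃ ((Π_r)_{K_jK_r})_w`.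
Hence the strong multiplicity one theorem gives (DC)" — the Satake-parameter content of that
sentence; strong multiplicity one is not asserted. [cite: Kim2002, §4.2, proof of Thm. 4.2.3, p. 157] -/
theorem AutomorphicRepData.eventually_descentCondition_of_wedgeTwoLifts
    {K' : Type} [Field K'] [NumberField K'] [Algebra F K'] [Algebra K' L] [IsScalarTower F K' L]
    {hK'4 : isCompact_glFiniteIntegralLevel 4 K'} {hK'6 : isCompact_glFiniteIntegralLevel 6 K'}
    (π : AutomorphicRepData (AutomorphyDatum.gl 4 F hF4))
    (πK : AutomorphicRepData (AutomorphyDatum.gl 4 K hK4))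
    (PK : AutomorphicRepData (AutomorphyDatum.gl 6 K hK6))
    (πK' : AutomorphicRepData (AutomorphyDatum.gl 4 K' hK'4))
    (PK' : AutomorphicRepData (AutomorphyDatum.gl 6 K' hK'6))
    (hπK : ∀ᶠ u : HeightOneSpectrum (𝓞 K) in cofinite,
      ∀ (v : HeightOneSpectrum (𝓞 F)) (α : Multiset ℂ), u.asIdeal.under (𝓞 F) = v.asIdeal →
        π.HasSatakeParamAt v α → πK.HasSatakeParamAt u (α.map (· ^ u.asIdeal.inertiaDeg (𝓞 F))))
    (hPK : ∀ᶠ u : HeightOneSpectrum (𝓞 K) in cofinite, ∀ β : Multiset ℂ,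
      πK.HasSatakeParamAt u β → PK.HasSatakeParamAt u (wedgeTwoParams β))
    (hπK' : ∀ᶠ u : HeightOneSpectrum (𝓞 K') in cofinite,
      ∀ (v : HeightOneSpectrum (𝓞 F)) (α : Multiset ℂ), u.asIdeal.under (𝓞 F) = v.asIdeal →
        π.HasSatakeParamAt v α → πK'.HasSatakeParamAt u (α.map (· ^ u.asIdeal.inertiaDeg (𝓞 F))))
    (hPK' : ∀ᶠ u : HeightOneSpectrum (𝓞 K') in cofinite, ∀ β : Multiset ℂ,
      πK'.HasSatakeParamAt u β → PK'.HasSatakeParamAt u (wedgeTwoParams β)) :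
    ∀ᶠ w : HeightOneSpectrum (𝓞 L) in cofinite, ∀ β γ : Multiset ℂ,
      PK.HasSatakeParamAt (w.under (𝓞 K)) β → PK'.HasSatakeParamAt (w.under (𝓞 K')) γ →
        β.map (· ^ w.asIdeal.inertiaDeg (𝓞 K)) = γ.map (· ^ w.asIdeal.inertiaDeg (𝓞 K')) := by
  have h1 := AutomorphicRepData.eventually_map_pow_eq_of_wedgeTwoLift_of_baseChange
    (L := L) π πK PK hπK hPK
  have h2 := AutomorphicRepData.eventually_map_pow_eq_of_wedgeTwoLift_of_baseChange
    (L := L) π πK' PK' hπK' hPK'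
  have hπ := eventually_cofinite_forall_under_eq (E := L) π.hasSatakeParamAt_cofinite_holds
  filter_upwards [h1, h2, hπ] with w h1 h2 hπ β γ hβ hγ
  have hv : w.asIdeal.under (𝓞 F) = (w.under (𝓞 F)).asIdeal := rfl
  obtain ⟨α, hα⟩ := hπ _ hv
  rw [h1 _ α β hv hα hβ, h2 _ α γ hv hα hγ]

end DescentCondition

/-! ### Theorem 4.2.3 from the leaves -/

section Leaves

variable {ρ : Type} [LT ρ] [WellFoundedLT ρ]
  (Good : ∀ (K : Type) [Field K] [NumberField K]
    (hK : ∀ m : ℕ, isCompact_glFiniteIntegralLevel m K), CuspidalAutomorphicRepData 4 K (hK 4) → Prop)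
  (rk : ∀ (K : Type) [Field K] [NumberField K]
    (hK : ∀ m : ℕ, isCompact_glFiniteIntegralLevel m K), CuspidalAutomorphicRepData 4 K (hK 4) → ρ)

variable
  /- `hGood`: Kim 2003, Thm. 4.1.1 with its proof (pp. 153–154): the converse theorem (Thm. 2.1
  [Co-PS1]) applied to `∧²π` with a finite non-empty exceptional set `S` outside which `π` is
  unramified gives `Π_v ≃ ∧²π_v` for ALL `v ∉ S`. -/
  (hGood : ∀ (K : Type) [Field K] [NumberField K]
    (hK : ∀ m : ℕ, isCompact_glFiniteIntegralLevel m K) (π : CuspidalAutomorphicRepData 4 K (hK 4)),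
    Good K hK π →
    ∀ S : Set (HeightOneSpectrum (𝓞 K)), S.Finite → S.Nonempty →
      (∀ v ∉ S, π.1.IsUnramifiedAt v) →
      ∃ P : AutomorphicRepData (AutomorphyDatum.gl 6 K (hK 6)),
        ∀ v ∉ S, ∀ α : Multiset ℂ, π.1.HasSatakeParamAt v α → P.HasSatakeParamAt v (wedgeTwoParams α))
  /- `hStep`: Kim 2003, pp. 156–157 (Thm. 4.2.1 [He1]; Grunwald–Wang [A-T, Ch. 10, Thm. 5]; class
  field theory; Chebotarev; Lemma 4.2.2 [Ra1, 3.6.2] and [Ra1, Prop. 2.3.1]; Arthur–Clozel Ch. 3,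
  Thm. 4.2 (a), Thm. 5.1): the fields `K_j`, the cuspidal base changes `π_{K_j}` with
  `r(π_{K_j}) < r(π)`, and the split places `w_j ∣ v_j`, for all `j` outside a finite set. -/
  (hStep : ∀ (K : Type) [Field K] [NumberField K]
    (hK : ∀ m : ℕ, isCompact_glFiniteIntegralLevel m K) (π : CuspidalAutomorphicRepData 4 K (hK 4)),
    ¬ Good K hK π →
    ∀ v : ℕ → HeightOneSpectrum (𝓞 K), (∀ j, π.1.IsUnramifiedAt (v j)) →
    ∃ (p : ℕ) (J : Set ℕ) (E : J → Type) (_ : ∀ j, Field (E j)) (_ : ∀ j, NumberField (E j))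
      (_ : ∀ j, Algebra K (E j)) (hE : ∀ (j : J) (m : ℕ), isCompact_glFiniteIntegralLevel m (E j))
      (πE : ∀ j : J, CuspidalAutomorphicRepData 4 (E j) (hE j 4)),
      p.Prime ∧ Jᶜ.Finite ∧ (∀ j, IsGalois K (E j)) ∧ (∀ j, Module.finrank K (E j) = p) ∧
      (∀ j r, j ≠ r → IsEmpty (E j ≃ₐ[K] E r)) ∧
      (∀ j, rk (E j) (hE j) (πE j) < rk K hK π) ∧
      (∀ (j : J) (w : HeightOneSpectrum (𝓞 (E j))) (u : HeightOneSpectrum (𝓞 K)) (α : Multiset ℂ),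
        w.asIdeal.under (𝓞 K) = u.asIdeal → π.1.HasSatakeParamAt u α →
          (πE j).1.HasSatakeParamAt w (α.map (· ^ w.asIdeal.inertiaDeg (𝓞 K)))) ∧
      (∀ j : J, ∃ w : HeightOneSpectrum (𝓞 (E j)), w.asIdeal.under (𝓞 K) = (v j).asIdeal ∧
        w.asIdeal.inertiaDeg (𝓞 K) = 1 ∧ w.asIdeal.ramificationIdx (𝓞 K) = 1))
  /- `hDescent`: Kim 2003, Prop. 4.2.4 ([Ra1, §3.6]) and Prop. 4.2.5 (Appendix 1), with Remark 4.2,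
  on Satake parameters; the conclusion `Π_{K_j} ≃ Π_j` (a.a. `j`) is rendered at the places of `K_j`
  split over `F` (Arthur–Clozel Ch. 3, (1.1), Thm. 5.1). -/
  (hDescent : ∀ (F : Type) [Field F] [NumberField F]
    (hF : ∀ m : ℕ, isCompact_glFiniteIntegralLevel m F) (n p : ℕ), p.Prime →
    ∀ (ι : Type) [Countable ι] [Infinite ι] (K : ι → Type) [∀ j, Field (K j)]
      [∀ j, NumberField (K j)] [∀ j, Algebra F (K j)],
      (∀ j, IsGalois F (K j)) → (∀ j, Module.finrank F (K j) = p) →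
      (∀ j r, j ≠ r → IsEmpty (K j ≃ₐ[F] K r)) →
    ∀ (hK : ∀ (j : ι) (m : ℕ), isCompact_glFiniteIntegralLevel m (K j))
      (Q : ∀ j, AutomorphicRepData (AutomorphyDatum.gl n (K j) (hK j n))),
      (∀ j, ∃ (k : ℕ) (m : Fin k → ℕ)
          (σ : ∀ i : Fin k, CuspidalAutomorphicRepData (m i) (K j) (hK j (m i))),
        (∑ i, m i = n) ∧ ∀ᶠ w : HeightOneSpectrum (𝓞 (K j)) in cofinite, ∀ β : Fin k → Multiset ℂ,
          (∀ i, (σ i).1.HasSatakeParamAt w (β i)) → (Q j).HasSatakeParamAt w (∑ i, β i)) →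
      (∀ (j r : ι) (L : Type) [Field L] [NumberField L] [Algebra F L] [Algebra (K j) L]
          [Algebra (K r) L] [IsScalarTower F (K j) L] [IsScalarTower F (K r) L],
        ∀ᶠ w : HeightOneSpectrum (𝓞 L) in cofinite, ∀ β γ : Multiset ℂ,
          (Q j).HasSatakeParamAt (w.under (𝓞 (K j))) β →
            (Q r).HasSatakeParamAt (w.under (𝓞 (K r))) γ →
              β.map (· ^ w.asIdeal.inertiaDeg (𝓞 (K j))) =
                γ.map (· ^ w.asIdeal.inertiaDeg (𝓞 (K r)))) →
      ∃ P : AutomorphicRepData (AutomorphyDatum.gl n F (hF n)),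
        ∀ᶠ j : ι in cofinite, ∀ (w : HeightOneSpectrum (𝓞 (K j))) (v : HeightOneSpectrum (𝓞 F)),
          w.asIdeal.under (𝓞 F) = v.asIdeal → w.asIdeal.inertiaDeg (𝓞 F) = 1 →
            w.asIdeal.ramificationIdx (𝓞 F) = 1 →
              ∀ β : Multiset ℂ, (Q j).HasSatakeParamAt w β → P.HasSatakeParamAt v β)
  /- `hSupp`: Kim 2003, (4.1) p. 154 ([J-S3]); Langlands 1979, Prop. 2: cuspidal support of an
  automorphic representation, on Satake parameters. -/
  (hSupp : ∀ (F : Type) [Field F] [NumberField F]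
    (hF : ∀ m : ℕ, isCompact_glFiniteIntegralLevel m F) (n : ℕ)
    (P : AutomorphicRepData (AutomorphyDatum.gl n F (hF n))),
    ∃ (k : ℕ) (m : Fin k → ℕ) (σ : ∀ i : Fin k, CuspidalAutomorphicRepData (m i) F (hF (m i))),
      (∑ i, m i = n) ∧ ∀ᶠ v : HeightOneSpectrum (𝓞 F) in cofinite, ∀ β : Fin k → Multiset ℂ,
        (∀ i, (σ i).1.HasSatakeParamAt v (β i)) → P.HasSatakeParamAt v (∑ i, β i))

include hGood hStep hDescent hSupp in
/-- **Kim 2003, Theorem 4.2.3, by the induction of §4.2 (pp. 156–158) — from the leaves.** Grant: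
the good case with its exceptional set (`hGood`, Thm. 4.1.1: converse theorem + Langlands–Shahidi
method), the family of the induction step (`hStep`: Henniart's Thm. 4.2.1, Grunwald–Wang, cyclic
base change of Arthur–Clozel with `r(π_{K_j}) < r(π)`, split places `w_j ∣ v_j`), Ramakrishnan's
descent criterion for isobaric families (`hDescent`, Prop. 4.2.4–4.2.5) and cuspidal support
(`hSupp`, (4.1) / Langlands 1979, Prop. 2), for an arbitrary goodness predicate `Good` and rank
function `rk` into a well-founded order. Then for every cuspidal `π` on `GL₄(𝔸_K)` and every finite
place `u` of `K` there is an automorphic `P` on `GL₆(𝔸_K)` which is a weak exterior square lift of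
`π` (`t_{P,v} = ∧² t_{π,v}` for almost all `v`) AND is exact at `u` (`t_{P,u} = ∧² t_{π,u}` if `π` is
unramified at `u`). Proof: well-founded induction on `rk π` over all number fields; good `π`:
`hGood` with `S = {ramified places of π} ∪ {v₀}`, `v₀ ≠ u`; otherwise enumerate the unramified places
of `π` with infinite multiplicity (`exists_enum_infinite_fiber`), take the family of `hStep`, the
lifts `Π_j` of `π_{K_j}` exact at `w_j` (induction hypothesis), verify (DC)
(`AutomorphicRepData.eventually_descentCondition_of_wedgeTwoLifts`), descend (`hDescent`), and read
off `t_{Π,v_j} = t_{Π_j,w_j} = ∧² t_{π_{K_j},w_j} = ∧² t_{π,v_j}` for all but finitely many `j`, i.e. at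
every unramified place (module docstring, "one point of rigour").
[cite: Kim2002, Thm. 4.2.3 and its proof, §4.2, pp. 156–158] -/
theorem Kim2003_exteriorSquare_GL4.exists_weakLift_exactAt_of_leaves
    (K : Type) [Field K] [NumberField K] (hK : ∀ m : ℕ, isCompact_glFiniteIntegralLevel m K)
    (π : CuspidalAutomorphicRepData 4 K (hK 4)) (u : HeightOneSpectrum (𝓞 K)) :
    ∃ P : AutomorphicRepData (AutomorphyDatum.gl 6 K (hK 6)),
      (∀ᶠ v : HeightOneSpectrum (𝓞 K) in cofinite, ∀ α : Multiset ℂ,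
        π.1.HasSatakeParamAt v α → P.HasSatakeParamAt v (wedgeTwoParams α)) ∧
      ∀ α : Multiset ℂ, π.1.HasSatakeParamAt u α → P.HasSatakeParamAt u (wedgeTwoParams α) := by
  -- well-founded induction on `rk π`, over all number fields
  suffices h : ∀ (r : ρ) (K : Type) [Field K] [NumberField K]
      (hK : ∀ m : ℕ, isCompact_glFiniteIntegralLevel m K) (π : CuspidalAutomorphicRepData 4 K (hK 4)),
      rk K hK π = r → ∀ u : HeightOneSpectrum (𝓞 K),
      ∃ P : AutomorphicRepData (AutomorphyDatum.gl 6 K (hK 6)),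
        (∀ᶠ v : HeightOneSpectrum (𝓞 K) in cofinite, ∀ α : Multiset ℂ,
          π.1.HasSatakeParamAt v α → P.HasSatakeParamAt v (wedgeTwoParams α)) ∧
        ∀ α : Multiset ℂ, π.1.HasSatakeParamAt u α → P.HasSatakeParamAt u (wedgeTwoParams α) from
    h _ K hK π rfl u
  intro r
  induction r using WellFoundedLT.induction with | ind r ih
  intro K _ _ hK π hr u
  haveI := infinite_heightOneSpectrum K
  haveI : Countable (HeightOneSpectrum (𝓞 K)) := countable_heightOneSpectrum K
  have hcof : ∀ᶠ v : HeightOneSpectrum (𝓞 K) in cofinite, π.1.IsUnramifiedAt v :=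
    π.1.hasSatakeParamAt_cofinite_holds
  by_cases hg : Good K hK π
  · /- the good case (Thm. 4.1.1): converse theorem with the exceptional set
    `S = {ramified places} ∪ {v₀}`, `v₀ ≠ u` -/
    obtain ⟨v₀, hv₀⟩ := exists_ne u
    have hSfin : ({v | ¬ π.1.IsUnramifiedAt v} ∪ {v₀} : Set (HeightOneSpectrum (𝓞 K))).Finite :=
      (Filter.eventually_cofinite.mp hcof).union (Set.finite_singleton v₀)
    have hSun : ∀ v ∉ ({v | ¬ π.1.IsUnramifiedAt v} ∪ {v₀} : Set (HeightOneSpectrum (𝓞 K))),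
        π.1.IsUnramifiedAt v := by
      intro v hv
      by_contra h
      exact hv (Or.inl h)
    obtain ⟨P, hP⟩ := hGood K hK π hg _ hSfin ⟨v₀, Or.inr rfl⟩ hSun
    refine ⟨P, ?_, fun α hα => hP u ?_ α hα⟩
    · filter_upwards [hSfin.compl_mem_cofinite] with v hv α hα
      exact hP v hv α hα
    · rintro (h | h)
      · exact h ⟨α, hα⟩
      · exact hv₀ (Set.mem_singleton_iff.mp h).symm
  · /- the induction step (§4.2): enumerate the unramified places with infinite multiplicity,
    base change along the family of `hStep`, lift by induction (exactly at `w_j`), descend -/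
    obtain ⟨u₁, hu₁⟩ := hcof.exists
    obtain ⟨e, he, hfib⟩ :=
      exists_enum_infinite_fiber (s := {v | π.1.IsUnramifiedAt v}) ⟨u₁, hu₁⟩
    obtain ⟨p, J, E, _, _, _, hE, πE, hp, hJ, hGal, hdeg, hdist, hrk, hBC, hsplit⟩ :=
      hStep K hK π hg e he
    choose w hw using hsplit
    -- the induction hypothesis: a weak lift `Π_j` of `π_{K_j}`, exact at the split place `w_j`
    have ih' : ∀ j : J, ∃ Q : AutomorphicRepData (AutomorphyDatum.gl 6 (E j) (hE j 6)),
        (∀ᶠ x : HeightOneSpectrum (𝓞 (E j)) in cofinite, ∀ β : Multiset ℂ,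
          (πE j).1.HasSatakeParamAt x β → Q.HasSatakeParamAt x (wedgeTwoParams β)) ∧
        ∀ β : Multiset ℂ, (πE j).1.HasSatakeParamAt (w j) β →
          Q.HasSatakeParamAt (w j) (wedgeTwoParams β) :=
      fun j => ih _ ((hrk j).trans_eq hr) (E j) (hE j) (πE j) rfl (w j)
    choose Q hQ using ih'
    haveI : Infinite J := Set.infinite_coe_iff.mpr (by simpa using hJ.infinite_compl)
    -- descent (Prop. 4.2.4–4.2.5), (DC) being verified on Satake parameters
    obtain ⟨P, hP⟩ := hDescent K hK 6 p hp J E hGal hdeg hdist hE Q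
      (fun j => hSupp (E j) (hE j) 6 (Q j))
      (fun j r L _ _ _ _ _ _ _ =>
        AutomorphicRepData.eventually_descentCondition_of_wedgeTwoLifts π.1 (πE j).1 (Q j)
          (πE r).1 (Q r) (Eventually.of_forall (hBC j)) (hQ j).1 (Eventually.of_forall (hBC r))
          (hQ r).1)
    rw [Filter.eventually_cofinite] at hP
    -- the descended `P` is exact at EVERY unramified place of `π`
    have hexact : ∀ (u' : HeightOneSpectrum (𝓞 K)) (α : Multiset ℂ),
        π.1.HasSatakeParamAt u' α → P.HasSatakeParamAt u' (wedgeTwoParams α) := by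
      intro u' α hα
      by_contra hcon
      refine hfib u' ⟨α, hα⟩ (((hP.image Subtype.val).union hJ).subset fun j hj => ?_)
      have hj' : e j = u' := hj
      by_cases hjJ : j ∈ J
      · refine Or.inl ⟨⟨j, hjJ⟩, fun hgood => hcon ?_, rfl⟩
        have hwu : (w ⟨j, hjJ⟩).asIdeal.under (𝓞 K) = u'.asIdeal := by
          rw [(hw ⟨j, hjJ⟩).1, ← hj']
        have h1 : (πE ⟨j, hjJ⟩).1.HasSatakeParamAt (w ⟨j, hjJ⟩) α := by
          simpa [(hw ⟨j, hjJ⟩).2.1] using hBC ⟨j, hjJ⟩ (w ⟨j, hjJ⟩) u' α hwu hα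
        exact hgood (w ⟨j, hjJ⟩) u' hwu (hw _).2.1 (hw _).2.2 _ ((hQ ⟨j, hjJ⟩).2 α h1)
      · exact Or.inr hjJ
    exact ⟨P, Eventually.of_forall hexact, hexact u⟩

include hGood hStep hDescent hSupp in
/-- **`Kim2003_exteriorSquare_GL4` (Kim 2003, Thm. A in its weak form = Thm. 4.2.3) from the leaves
of its printed proof** (§4.2, pp. 156–158, "We follow [Ra1] closely"): the good case with its
exceptional set (`hGood` — Thm. 4.1.1: the converse theorem of Cogdell–Piatetski-Shapiro applied to
`∧²π`, §§2–4.1), the family of the induction step (`hStep` — Henniart's Thm. 4.2.1, Grunwald–Wang,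
Arthur–Clozel base change), Ramakrishnan's descent criterion (`hDescent` — Prop. 4.2.4–4.2.5) and
cuspidal support (`hSupp` — (4.1), Langlands 1979 Prop. 2), for any goodness predicate and rank
function for which they hold (Kim: "good" = no supercuspidal component, `r(π) = (l(π), p(π))`).
Clause (i) of the fact is `exists_weakLift_exactAt_of_leaves`; clause (ii) (`Π = τ₁ ⊞ ⋯ ⊞ τ_k` on
Satake parameters) is `hSupp` for the `P` so obtained, as in Kim's text ((4.1), p. 154).
[cite: Kim2002, Thm. 4.2.3 (p. 156) with §4.2 (pp. 156–158) and (4.1) (p. 154)] -/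
theorem Kim2003_exteriorSquare_GL4.of_leaves : Kim2003_exteriorSquare_GL4 := by
  intro F _ _ hF π
  haveI := infinite_heightOneSpectrum F
  obtain ⟨u⟩ := (inferInstance : Nonempty (HeightOneSpectrum (𝓞 F)))
  obtain ⟨P, hP, -⟩ := Kim2003_exteriorSquare_GL4.exists_weakLift_exactAt_of_leaves Good rk hGood
    hStep hDescent hSupp F hF π u
  exact ⟨P, hP, hSupp F hF 6 P⟩

include hDescent hSupp in
/-- **`Kim2003_exteriorSquare_GL4` from four closed leaves** — `Kim2003_exteriorSquare_GL4.of_leaves`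
with Kim's goodness predicate (p. 153: "Following [Ra1], we say `π` is good if none of `π_v` is
supercuspidal"; rendered through the tree's local components of a Borel–Jacquet datum,
`AutomorphicRepData.HasLocalComponentAt` of `LocalComponentBJ`, and Harish-Chandra's
`Representation.IsSupercuspidal` of `MatrixCoefficients`: every irreducible smooth local
component of `π` at every finite place is non-supercuspidal) and with the rank function
`r(π) = (l(π), p(π))` of p. 156 quantified existentially inside the induction-step leaf (any
well-founded strict order). The four hypotheses are now closed statements: `hGood` = Thm. 4.1.1
with its exceptional set (pp. 153–154), `hStep` = the family of pp. 156–157 (Thm. 4.2.1 [He1],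
Grunwald–Wang, Arthur–Clozel Ch. 3 Thm. 4.2 (a) / 5.1, Lemma 4.2.2, "`r(π_{K_j}) < r`"),
`hDescent` = Prop. 4.2.4–4.2.5, `hSupp` = (4.1) / Langlands 1979 Prop. 2.
[cite: Kim2002, Thm. 4.2.3 (p. 156) with §4.1 (p. 153) and §4.2 (pp. 156–158)] -/
theorem Kim2003_exteriorSquare_GL4.of_leaves'
    (hGood : ∀ (K : Type) [Field K] [NumberField K]
      (hK : ∀ m : ℕ, isCompact_glFiniteIntegralLevel m K) (π : CuspidalAutomorphicRepData 4 K (hK 4)),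
      (∀ (v : HeightOneSpectrum (𝓞 K)) (πv : SmoothIrrep (GL (Fin 4) (v.adicCompletion K))),
          π.1.HasLocalComponentAt v πv.ρ → ¬ πv.ρ.IsSupercuspidal) →
      ∀ S : Set (HeightOneSpectrum (𝓞 K)), S.Finite → S.Nonempty →
        (∀ v ∉ S, π.1.IsUnramifiedAt v) →
        ∃ P : AutomorphicRepData (AutomorphyDatum.gl 6 K (hK 6)),
          ∀ v ∉ S, ∀ α : Multiset ℂ,
            π.1.HasSatakeParamAt v α → P.HasSatakeParamAt v (wedgeTwoParams α))
    (hStep : ∃ (ρ₀ : Type) (_ : LT ρ₀) (_ : WellFoundedLT ρ₀)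
        (rk : ∀ (K : Type) [Field K] [NumberField K]
          (hK : ∀ m : ℕ, isCompact_glFiniteIntegralLevel m K), CuspidalAutomorphicRepData 4 K (hK 4) → ρ₀),
      ∀ (K : Type) [Field K] [NumberField K]
        (hK : ∀ m : ℕ, isCompact_glFiniteIntegralLevel m K) (π : CuspidalAutomorphicRepData 4 K (hK 4)),
        ¬ (∀ (v : HeightOneSpectrum (𝓞 K)) (πv : SmoothIrrep (GL (Fin 4) (v.adicCompletion K))),
            π.1.HasLocalComponentAt v πv.ρ → ¬ πv.ρ.IsSupercuspidal) →
        ∀ v : ℕ → HeightOneSpectrum (𝓞 K), (∀ j, π.1.IsUnramifiedAt (v j)) →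
        ∃ (p : ℕ) (J : Set ℕ) (E : J → Type) (_ : ∀ j, Field (E j)) (_ : ∀ j, NumberField (E j))
          (_ : ∀ j, Algebra K (E j)) (hE : ∀ (j : J) (m : ℕ), isCompact_glFiniteIntegralLevel m (E j))
          (πE : ∀ j : J, CuspidalAutomorphicRepData 4 (E j) (hE j 4)),
          p.Prime ∧ Jᶜ.Finite ∧ (∀ j, IsGalois K (E j)) ∧ (∀ j, Module.finrank K (E j) = p) ∧
          (∀ j r, j ≠ r → IsEmpty (E j ≃ₐ[K] E r)) ∧
          (∀ j, rk (E j) (hE j) (πE j) < rk K hK π) ∧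
          (∀ (j : J) (w : HeightOneSpectrum (𝓞 (E j))) (u : HeightOneSpectrum (𝓞 K))
              (α : Multiset ℂ), w.asIdeal.under (𝓞 K) = u.asIdeal → π.1.HasSatakeParamAt u α →
            (πE j).1.HasSatakeParamAt w (α.map (· ^ w.asIdeal.inertiaDeg (𝓞 K)))) ∧
          (∀ j : J, ∃ w : HeightOneSpectrum (𝓞 (E j)), w.asIdeal.under (𝓞 K) = (v j).asIdeal ∧
            w.asIdeal.inertiaDeg (𝓞 K) = 1 ∧ w.asIdeal.ramificationIdx (𝓞 K) = 1)) :
    Kim2003_exteriorSquare_GL4 := by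
  obtain ⟨ρ₀, _, _, rk₀, hStep₀⟩ := hStep
  exact Kim2003_exteriorSquare_GL4.of_leaves
    (fun K _ _ hK π => ∀ (v : HeightOneSpectrum (𝓞 K))
      (πv : SmoothIrrep (GL (Fin 4) (v.adicCompletion K))),
        π.1.HasLocalComponentAt v πv.ρ → ¬ πv.ρ.IsSupercuspidal)
    rk₀ hGood hStep₀ hDescent hSupp

end Leaves

end Literature.NumberTheory.Automorphic

end
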